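import Summits.FinalStateConjecture.FinalStateConjecture.Theorems.BulkKerrCapture.Negative.DegenerateCentres

/-!
# `BulkKerrCapture` — negative-side analysis of the stubs of line `frozen-charge-flat-modulus`

Crux `stmt-FinalStateConjecture-10696` (route `PhaseMixingCapture`, rank 4), standing disprover
`cdisprove`, cycle 3 (2026-08-16). The picked line's skeleton
(`Cruxes/BulkKerrCapture/Lines/frozen-charge-flat-modulus.lean`, sha `294962749d2a`) registers four
stubs S1 `LocalKerrConvergence`, S2 `FarCompleteNullInfinity`, S3 `LipschitzFinalState`,
S4 `SpinReflection`. Each is the `∀`-closure over the centre `χ₀ ∈ (−1, 1)` (and over `k`, resp.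
over the spacetime) of a predicate defined here:
`S1 = ∀ [Kerr.Facts] [Kerr.SliceFacts] χ₀, |χ₀| < 1 → ∀ k, LocalConvergenceNear χ₀ k`,
`S2 = ∀ … χ₀, |χ₀| < 1 → FarCompleteNear χ₀`, `S3 = ∀ … χ₀, |χ₀| < 1 → LipschitzNear χ₀`,
`S4 = ∀ 𝓢, SpinReflectionAt 𝓢` (bodies verbatim). Results (all sorry-free):

* `farCompleteNear_of_bulkKerrCapture` — **the crux implies S2**: a spin window
  `|a/M − χ₀| < (1 − |χ₀|)/2` lies in the compact spin set `|a| ≤ a₁M`, `a₁ = (1 + |χ₀|)/2 < 1`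
  (`spin_le_of_window`), on which the crux's `CaptureAt` gives far-complete `𝓘⁺`.
* `localConvergenceNear_exists_k_of_bulkKerrCapture` — **the crux implies S1 with `∃ k` in place
  of `∀ k`**; the upgrade to every `Cᵏ` is S1's only content beyond the crux.
* `kerrLimitRigidity_of_lipschitzNear` — **S3 at the centre of its ball is Kerr-limit rigidity**
  (`KerrLimitRigidity k₀ M a`: every sub-extremal `Cᵏ`-Kerr limit, `k ≥ k₀`, of every MGHD of the
  exact datum `Kerr.data M a M` has `(M', |a'|) = (M, |a|)`), modulo the constraint fact of that
  one datum; `kerrLimitRigidity_schwarzschild_of_lipschitzNear` (no named fact);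
  `not_lipschitzNear_zero_of_wrongLimit` — kill template: one MGHD of one Schwarzschild datum
  converging in every `Cᵏ` to a Kerr exterior with `(M', a') ≠ (M, 0)` refutes S3 at `χ₀ = 0`.
* `not_lipschitzSignedNear_of_convergent_mghd`, `not_lipschitzSignedNear` — **the absolute values
  in S3 are load-bearing**: the sign-sensitive universal modulus `LipschitzSignedNear` (S3 with
  `|a' − a|` for all limits) is FALSE at every rotating sub-extremal centre, given spin reflection
  (S4) and one maximal development of the centre datum converging to some sub-extremal Kerr in
  `C^{k₀}` (supplied by S1 + Choquet-Bruhat–Geroch + the constraint fact). No universal-over-limits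
  statement over the tree's orientation-blind `ConvergesToKerr` can orient the final spin.

Companion files: `SpinGapAndMass.lean`, `PointwiseVsUniform.lean`, `DegenerateCentres.lean`,
`NormalForm.lean`, `SchwarzschildCentre.lean` (cycles 1–2). Workfile with the prose analysis:
`Cruxes/BulkKerrCapture/Disproof.lean` §6.
-/

noncomputable section

-- the Theorems namespace prescribed by the layout repeats the summit name
set_option linter.dupNamespace false

open Set
open scoped Manifold ENNReal ContDiff

namespace Summit.FinalStateConjecture.FinalStateConjecture.Theorems.BulkKerrCapture.Negative

open Literature.Geometry.Lorentzian
open Summit.FinalStateConjecture.FinalStateConjecture.Theses.PhaseMixingCapture (BulkKerrCapture)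

/-! ## The stub bodies as predicates of the centre -/

/-- Body of S1 at the centre `χ₀` and order `k`: exponents `(s, δ)`, a spin radius `η` and per
mass one basin `ε` such that every vacuum datum in the `H^s_δ`-ball around `Kerr.data M a M`,
`|a/M − χ₀| < η`, `|a| < M`, has all its MGHDs converging in `Cᵏ` to SOME sub-extremal Kerr
exterior (skeleton `LocalKerrConvergence` = `∀ χ₀, |χ₀| < 1 → ∀ k, LocalConvergenceNear χ₀ k`).
[folklore] -/
def LocalConvergenceNear [Kerr.Facts] [Kerr.SliceFacts] (χ₀ : ℝ) (k : ℕ) : Prop :=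
  ∃ (s : ℕ) (δ : ℝ), ∃ η > (0 : ℝ), ∀ (M : ℝ) (hM : 0 < M), ∃ ε > (0 : ℝ), ∀ a : ℝ,
    |a / M - χ₀| < η → |a| < M →
      ∀ (D : InitialDataSet 𝓘(ℝ, E3) (Kerr.slice a M)) [D.metric.HasLeviCivita],
        D.IsVacuumConstraintSolution →
        InitialDataSet.dataWeightedSobolevEDist s δ D (Kerr.data M a M hM.le) <
          ENNReal.ofReal ε →
        ∀ 𝒟 : VacuumCauchyDevelopment D, 𝒟.IsMaximal →
          ∃ (M' a' : ℝ) (𝒟oc : Set 𝒟.carrier), Kerr.IsSubextremal M' a' ∧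
            𝒟.toSpacetime.ConvergesToKerr 𝒟oc M' a' k

/-- Body of S2 at the centre `χ₀`: far-complete `𝓘⁺` of every MGHD on a local ball, basin uniform
on a spin window (skeleton `FarCompleteNullInfinity` = `∀ χ₀, |χ₀| < 1 → FarCompleteNear χ₀`).
[folklore] -/
def FarCompleteNear [Kerr.Facts] [Kerr.SliceFacts] (χ₀ : ℝ) : Prop :=
  ∃ (s : ℕ) (δ : ℝ), ∃ η > (0 : ℝ), ∀ (M : ℝ) (hM : 0 < M), ∃ ε > (0 : ℝ), ∀ a : ℝ,
    |a / M - χ₀| < η → |a| < M →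
      ∀ (D : InitialDataSet 𝓘(ℝ, E3) (Kerr.slice a M)) [D.metric.HasLeviCivita],
        D.IsVacuumConstraintSolution →
        InitialDataSet.dataWeightedSobolevEDist s δ D (Kerr.data M a M hM.le) <
          ENNReal.ofReal ε →
        ∀ 𝒟 : VacuumCauchyDevelopment D, 𝒟.IsMaximal → 𝒟.HasCompleteFutureNullInfinityFar

/-- Body of S3 at the centre `χ₀` (the line's lever): `(s, δ, k₀, η)` and per mass `(ε, L)` such
that for every datum in the ball, EVERY sub-extremal `Cᵏ`-Kerr limit `g_{M',a'}`, `k ≥ k₀`, of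
every MGHD obeys `|M' − M| + ||a'| − |a|| ≤ L · dist` (skeleton `LipschitzFinalState` =
`∀ χ₀, |χ₀| < 1 → LipschitzNear χ₀`). [folklore] -/
def LipschitzNear [Kerr.Facts] [Kerr.SliceFacts] (χ₀ : ℝ) : Prop :=
  ∃ (s : ℕ) (δ : ℝ) (k₀ : ℕ), ∃ η > (0 : ℝ), ∀ (M : ℝ) (hM : 0 < M), ∃ ε > (0 : ℝ), ∃ L : ℝ,
    ∀ a : ℝ, |a / M - χ₀| < η → |a| < M →
      ∀ (D : InitialDataSet 𝓘(ℝ, E3) (Kerr.slice a M)) [D.metric.HasLeviCivita],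
        D.IsVacuumConstraintSolution →
        InitialDataSet.dataWeightedSobolevEDist s δ D (Kerr.data M a M hM.le) <
          ENNReal.ofReal ε →
        ∀ 𝒟 : VacuumCauchyDevelopment D, 𝒟.IsMaximal →
          ∀ (M' a' : ℝ) (𝒟oc : Set 𝒟.carrier) (k : ℕ), k₀ ≤ k → Kerr.IsSubextremal M' a' →
            𝒟.toSpacetime.ConvergesToKerr 𝒟oc M' a' k →
            |M' - M| + abs (|a'| - |a|) ≤
              L * (InitialDataSet.dataWeightedSobolevEDist s δ D (Kerr.data M a M hM.le)).toReal

/-- The SIGN-SENSITIVE variant of the body of S3: `|a' − a|` in place of `||a'| − |a||`. The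
natural strengthening one would write first; FALSE at rotating centres
(`not_lipschitzSignedNear_of_convergent_mghd`). [folklore] -/
def LipschitzSignedNear [Kerr.Facts] [Kerr.SliceFacts] (χ₀ : ℝ) : Prop :=
  ∃ (s : ℕ) (δ : ℝ) (k₀ : ℕ), ∃ η > (0 : ℝ), ∀ (M : ℝ) (hM : 0 < M), ∃ ε > (0 : ℝ), ∃ L : ℝ,
    ∀ a : ℝ, |a / M - χ₀| < η → |a| < M →
      ∀ (D : InitialDataSet 𝓘(ℝ, E3) (Kerr.slice a M)) [D.metric.HasLeviCivita],
        D.IsVacuumConstraintSolution →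
        InitialDataSet.dataWeightedSobolevEDist s δ D (Kerr.data M a M hM.le) <
          ENNReal.ofReal ε →
        ∀ 𝒟 : VacuumCauchyDevelopment D, 𝒟.IsMaximal →
          ∀ (M' a' : ℝ) (𝒟oc : Set 𝒟.carrier) (k : ℕ), k₀ ≤ k → Kerr.IsSubextremal M' a' →
            𝒟.toSpacetime.ConvergesToKerr 𝒟oc M' a' k →
            |M' - M| + |a' - a| ≤
              L * (InitialDataSet.dataWeightedSobolevEDist s δ D (Kerr.data M a M hM.le)).toReal

/-- Body of S4 at the spacetime `𝓢`: `ConvergesToKerr` is blind to the orientation of the spin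
(skeleton `SpinReflection` = `∀ 𝓢, SpinReflectionAt 𝓢`; TRUE for the tree's Kerr–Schild form,
`g_{M,−a}(x)(v, w) = g_{M,a}(Rx)(Rv, Rw)` for `R : x₂ ↦ −x₂`). [folklore] -/
def SpinReflectionAt (𝓢 : Spacetime.{0} 4) : Prop :=
  ∀ (𝒟 : Set 𝓢.carrier) (M a : ℝ) (k : ℕ), 𝓢.ConvergesToKerr 𝒟 M a k → 𝓢.ConvergesToKerr 𝒟 M (-a) k

/-- **Kerr-limit rigidity at order `k₀`** for the exact datum `Kerr.data M a M`: every
sub-extremal Kerr exterior `g_{M',a'}` to which some region of some MGHD of the datum converges in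
`Cᵏ`, `k ≥ k₀`, has `M' = M` and `|a'| = |a|`. [folklore] -/
def KerrLimitRigidity [Kerr.Facts] [Kerr.SliceFacts] (k₀ : ℕ) (M : ℝ) (hM : 0 ≤ M) (a : ℝ) :
    Prop :=
  ∀ 𝒟 : VacuumCauchyDevelopment (Kerr.data M a M hM), 𝒟.IsMaximal →
    ∀ (M' a' : ℝ) (𝒟oc : Set 𝒟.carrier) (k : ℕ), k₀ ≤ k → Kerr.IsSubextremal M' a' →
      𝒟.toSpacetime.ConvergesToKerr 𝒟oc M' a' k → M' = M ∧ |a'| = |a|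

/-! ## S2 and S1 are necessary for the crux -/

/-- A spin window `|a/M − χ₀| < (1 − |χ₀|)/2` lies in the compact spin set `|a| ≤ a₁ M` with
`a₁ = (1 + |χ₀|)/2`. [folklore] -/
theorem spin_le_of_window {χ₀ M a : ℝ} (hM : 0 < M) (h : |a / M - χ₀| < (1 - |χ₀|) / 2) :
    |a| ≤ (1 + |χ₀|) / 2 * M := by
  have h1 : |a / M| ≤ |a / M - χ₀| + |χ₀| := by
    calc |a / M| = |(a / M - χ₀) + χ₀| := by rw [sub_add_cancel]
      _ ≤ |a / M - χ₀| + |χ₀| := abs_add_le _ _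
  have h2 : |a / M| < (1 + |χ₀|) / 2 := by linarith
  rw [abs_div, abs_of_pos hM, div_lt_iff₀ hM] at h2
  exact h2.le

/-- **The crux implies S2** at every centre `|χ₀| < 1`: take `a₁ := (1 + |χ₀|)/2 < 1` in the crux
and `η := (1 − |χ₀|)/2`. S2 carries no risk beyond the crux itself. [folklore] -/
theorem farCompleteNear_of_bulkKerrCapture (h : BulkKerrCapture) [Kerr.Facts] [Kerr.SliceFacts]
    {χ₀ : ℝ} (hχ₀ : |χ₀| < 1) : FarCompleteNear χ₀ := by
  have ha₁ : (1 + |χ₀|) / 2 < 1 := by linarith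
  obtain ⟨s, δ, k, hk⟩ := (bulkKerrCapture_iff.1 h) ((1 + |χ₀|) / 2) ha₁
  refine ⟨s, δ, (1 - |χ₀|) / 2, by linarith, fun M hM ↦ ?_⟩
  obtain ⟨ε, hε, C, hC⟩ := hk M hM
  refine ⟨ε, hε, fun a ha _ D _ hvac hdist 𝒟 hmax ↦ ?_⟩
  obtain ⟨-, -, -, -, hfar, -, -⟩ := hC a (spin_le_of_window hM ha) D hvac hdist 𝒟 hmax
  exact hfar

/-- **The crux implies S1 with `∃ k` in place of `∀ k`** at every centre `|χ₀| < 1` (the crux's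
own `k`). The upgrade to every `k` is the stub's only content beyond the crux. [folklore] -/
theorem localConvergenceNear_exists_k_of_bulkKerrCapture (h : BulkKerrCapture) [Kerr.Facts]
    [Kerr.SliceFacts] {χ₀ : ℝ} (hχ₀ : |χ₀| < 1) : ∃ k : ℕ, LocalConvergenceNear χ₀ k := by
  have ha₁ : (1 + |χ₀|) / 2 < 1 := by linarith
  obtain ⟨s, δ, k, hk⟩ := (bulkKerrCapture_iff.1 h) ((1 + |χ₀|) / 2) ha₁
  refine ⟨k, s, δ, (1 - |χ₀|) / 2, by linarith, fun M hM ↦ ?_⟩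
  obtain ⟨ε, hε, C, hC⟩ := hk M hM
  refine ⟨ε, hε, fun a ha _ D _ hvac hdist 𝒟 hmax ↦ ?_⟩
  obtain ⟨M', a', 𝒟oc, hsub, -, hconv, -⟩ := hC a (spin_le_of_window hM ha) D hvac hdist 𝒟 hmax
  exact ⟨M', a', 𝒟oc, hsub, hconv⟩

/-! ## S3 at the centre of its ball: Kerr-limit rigidity -/

/-- **S3 near the centre `a/M` yields Kerr-limit rigidity for the datum `Kerr.data M a M`**
(modulo the constraint fact of that one datum): the distance is `0` there, so the Lipschitz bound
pins `(M', |a'|) = (M, |a|)` for EVERY admissible limit. [folklore] -/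
theorem kerrLimitRigidity_of_lipschitzNear [Kerr.Facts] [Kerr.SliceFacts] {M a : ℝ} (hM : 0 < M)
    (ha : Kerr.IsSubextremal M a) (h : LipschitzNear (a / M))
    (hvac : Kerr.data_isVacuumConstraintSolution M a M) :
    ∃ k₀ : ℕ, KerrLimitRigidity k₀ M hM.le a := by
  obtain ⟨s, δ, k₀, η, hη, hk⟩ := h
  obtain ⟨ε, hε, L, hL⟩ := hk M hM
  refine ⟨k₀, fun 𝒟 hmax M' a' 𝒟oc k hk₀ hsub hconv ↦ ?_⟩
  haveI := (Kerr.data M a M hM.le).metric.hasLeviCivita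
  have h0 : InitialDataSet.dataWeightedSobolevEDist s δ (Kerr.data M a M hM.le)
      (Kerr.data M a M hM.le) < ENNReal.ofReal ε := by
    rw [InitialDataSet.dataWeightedSobolevEDist_self]
    exact ENNReal.ofReal_pos.2 hε
  have hwin : |a / M - a / M| < η := by
    rw [sub_self, abs_zero]
    exact hη
  have hmod := hL a hwin ha _ (hvac hM.le) h0 𝒟 hmax M' a' 𝒟oc k hk₀ hsub hconv
  rw [InitialDataSet.dataWeightedSobolevEDist_self, ENNReal.toReal_zero, mul_zero] at hmod
  have h1 : |M' - M| ≤ 0 := by linarith [abs_nonneg (|a'| - |a|)]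
  have h2 : abs (|a'| - |a|) ≤ 0 := by linarith [abs_nonneg (M' - M)]
  exact ⟨by linarith [abs_le.1 h1], by linarith [abs_le.1 h2]⟩

/-- **S3 at the Schwarzschild centre `χ₀ = 0` — no named-fact hypothesis** (the `a = 0`
constraints are the tree theorem `Kerr.data_isVacuumConstraintSolution_zero`). [folklore] -/
theorem kerrLimitRigidity_schwarzschild_of_lipschitzNear [Kerr.Facts] [Kerr.SliceFacts] {M : ℝ}
    (hM : 0 < M) (h : LipschitzNear 0) : ∃ k₀ : ℕ, KerrLimitRigidity k₀ M hM.le 0 := by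
  refine kerrLimitRigidity_of_lipschitzNear hM (by unfold Kerr.IsSubextremal; simpa using hM)
    (by rwa [zero_div]) (Kerr.data_isVacuumConstraintSolution_zero M M)

/-- **Kill template for S3**: ONE maximal vacuum Cauchy development of ONE Schwarzschild slice
datum `Kerr.data M 0 M` with a region converging in every `Cᵏ` to a sub-extremal Kerr exterior
`g_{M',a'}`, `(M', a') ≠ (M, 0)`, refutes the body of S3 at `χ₀ = 0` (given the instances).
Expected impossible (Kerr-limit rigidity, for `k₀ ≥ 3` via third-order curvature invariants);
the precise residual obligation. [folklore] -/
theorem not_lipschitzNear_zero_of_wrongLimit [Kerr.Facts] [Kerr.SliceFacts] {M : ℝ} (hM : 0 < M)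
    (𝒟 : VacuumCauchyDevelopment (Kerr.data M 0 M hM.le)) (hmax : 𝒟.IsMaximal) {M' a' : ℝ}
    (hsub : Kerr.IsSubextremal M' a') (hne : M' ≠ M ∨ a' ≠ 0)
    (hconv : ∀ k : ℕ, ∃ 𝒟oc : Set 𝒟.carrier, 𝒟.toSpacetime.ConvergesToKerr 𝒟oc M' a' k) :
    ¬ LipschitzNear 0 := by
  intro h
  obtain ⟨k₀, hk₀⟩ := kerrLimitRigidity_schwarzschild_of_lipschitzNear hM h
  obtain ⟨𝒟oc, hc⟩ := hconv k₀
  obtain ⟨hM', ha'⟩ := hk₀ 𝒟 hmax M' a' 𝒟oc k₀ le_rfl hsub hc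
  rcases hne with h1 | h1
  · exact h1 hM'
  · exact h1 (by simpa using ha')

/-! ## The absolute values in S3 are load-bearing -/

/-- The signed body at the centre pins the SIGNED spin of every admissible limit. [folklore] -/
theorem signedRigidity_of_lipschitzSignedNear [Kerr.Facts] [Kerr.SliceFacts] {M a : ℝ}
    (hM : 0 < M) (ha : Kerr.IsSubextremal M a) (h : LipschitzSignedNear (a / M))
    (hvac : Kerr.data_isVacuumConstraintSolution M a M) :
    ∃ k₀ : ℕ, ∀ 𝒟 : VacuumCauchyDevelopment (Kerr.data M a M hM.le), 𝒟.IsMaximal →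
      ∀ (M' a' : ℝ) (𝒟oc : Set 𝒟.carrier) (k : ℕ), k₀ ≤ k → Kerr.IsSubextremal M' a' →
        𝒟.toSpacetime.ConvergesToKerr 𝒟oc M' a' k → M' = M ∧ a' = a := by
  obtain ⟨s, δ, k₀, η, hη, hk⟩ := h
  obtain ⟨ε, hε, L, hL⟩ := hk M hM
  refine ⟨k₀, fun 𝒟 hmax M' a' 𝒟oc k hk₀ hsub hconv ↦ ?_⟩
  haveI := (Kerr.data M a M hM.le).metric.hasLeviCivita
  have h0 : InitialDataSet.dataWeightedSobolevEDist s δ (Kerr.data M a M hM.le)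
      (Kerr.data M a M hM.le) < ENNReal.ofReal ε := by
    rw [InitialDataSet.dataWeightedSobolevEDist_self]
    exact ENNReal.ofReal_pos.2 hε
  have hwin : |a / M - a / M| < η := by
    rw [sub_self, abs_zero]
    exact hη
  have hmod := hL a hwin ha _ (hvac hM.le) h0 𝒟 hmax M' a' 𝒟oc k hk₀ hsub hconv
  rw [InitialDataSet.dataWeightedSobolevEDist_self, ENNReal.toReal_zero, mul_zero] at hmod
  have h1 : |M' - M| ≤ 0 := by linarith [abs_nonneg (a' - a)]
  have h2 : |a' - a| ≤ 0 := by linarith [abs_nonneg (M' - M)]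
  exact ⟨by linarith [abs_le.1 h1], by linarith [abs_le.1 h2]⟩

/-- Sub-extremality is blind to the sign of the spin. [folklore] -/
theorem isSubextremal_neg {M a : ℝ} (h : Kerr.IsSubextremal M a) : Kerr.IsSubextremal M (-a) := by
  unfold Kerr.IsSubextremal at h ⊢
  rwa [abs_neg]

/-- **The absolute values in S3 are load-bearing (core form).** Given spin reflection (S4) for
the developments concerned, the sign-sensitive universal modulus is FALSE at every rotating
sub-extremal centre `a ≠ 0` as soon as, for every `k`, SOME maximal development of
`Kerr.data M a M` converges in `Cᵏ` to SOME sub-extremal Kerr exterior: it converges to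
`g_{M',a'}` and (S4) to `g_{M',−a'}`, and the signed bound at distance `0` forces `a' = a` and
`−a' = a`. [folklore] -/
theorem not_lipschitzSignedNear_of_convergent_mghd [Kerr.Facts] [Kerr.SliceFacts] {M a : ℝ}
    (hM : 0 < M) (ha : Kerr.IsSubextremal M a) (ha0 : a ≠ 0)
    (hvac : Kerr.data_isVacuumConstraintSolution M a M)
    (h4 : ∀ 𝒟 : VacuumCauchyDevelopment (Kerr.data M a M hM.le), SpinReflectionAt 𝒟.toSpacetime)
    (hconv : ∀ k : ℕ, ∃ 𝒟 : VacuumCauchyDevelopment (Kerr.data M a M hM.le), 𝒟.IsMaximal ∧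
      ∃ (M' a' : ℝ) (𝒟oc : Set 𝒟.carrier), Kerr.IsSubextremal M' a' ∧
        𝒟.toSpacetime.ConvergesToKerr 𝒟oc M' a' k) :
    ¬ LipschitzSignedNear (a / M) := by
  intro h
  obtain ⟨k₀, hk₀⟩ := signedRigidity_of_lipschitzSignedNear hM ha h hvac
  obtain ⟨𝒟, hmax, M', a', 𝒟oc, hsub, hc⟩ := hconv k₀
  have hc' : 𝒟.toSpacetime.ConvergesToKerr 𝒟oc M' (-a') k₀ := h4 𝒟 𝒟oc M' a' k₀ hc
  obtain ⟨-, h1⟩ := hk₀ 𝒟 hmax M' a' 𝒟oc k₀ le_rfl hsub hc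
  obtain ⟨-, h2⟩ := hk₀ 𝒟 hmax M' (-a') 𝒟oc k₀ le_rfl (isSubextremal_neg hsub) hc'
  exact ha0 (by linarith)

/-- **The absolute values in S3 are load-bearing**, from the line's own stubs: S4 and S1 at the
centre `a/M` (the convergent limit), Choquet-Bruhat–Geroch (an MGHD of the centre datum) and the
constraint fact at `(M, a, M)` refute the signed modulus at every rotating sub-extremal centre.
[folklore] -/
theorem not_lipschitzSignedNear [Kerr.Facts] [Kerr.SliceFacts] {M a : ℝ} (hM : 0 < M)
    (ha : Kerr.IsSubextremal M a) (ha0 : a ≠ 0)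
    (hvac : Kerr.data_isVacuumConstraintSolution M a M)
    (h4 : ∀ 𝒟 : VacuumCauchyDevelopment (Kerr.data M a M hM.le), SpinReflectionAt 𝒟.toSpacetime)
    (h1 : ∀ k : ℕ, LocalConvergenceNear (a / M) k)
    (hMGHD : choquetBruhat_geroch_exists_mghd_cauchy) : ¬ LipschitzSignedNear (a / M) := by
  refine not_lipschitzSignedNear_of_convergent_mghd hM ha ha0 hvac h4 fun k ↦ ?_
  obtain ⟨s, δ, η, hη, hk⟩ := h1 k
  obtain ⟨ε, hε, hε'⟩ := hk M hM
  obtain ⟨𝒟, hmax⟩ := exists_mghd_kerrData_of hvac hMGHD hM.le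
  haveI := (Kerr.data M a M hM.le).metric.hasLeviCivita
  have h0 : InitialDataSet.dataWeightedSobolevEDist s δ (Kerr.data M a M hM.le)
      (Kerr.data M a M hM.le) < ENNReal.ofReal ε := by
    rw [InitialDataSet.dataWeightedSobolevEDist_self]
    exact ENNReal.ofReal_pos.2 hε
  have hwin : |a / M - a / M| < η := by
    rw [sub_self, abs_zero]
    exact hη
  obtain ⟨M', a', 𝒟oc, hsub, hc⟩ := hε' a hwin ha _ (hvac hM.le) h0 𝒟 hmax
  exact ⟨𝒟, hmax, M', a', 𝒟oc, hsub, hc⟩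

end Summit.FinalStateConjecture.FinalStateConjecture.Theorems.BulkKerrCapture.Negative

end
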